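import Mathlib
import Summits.Schanuel.Schanuel.Statement
import Literature.NumberTheory.Transcendental.RoyCriterion
import HarnessLib

/-!
# Exponent bookkeeping for Roy's window (solo-Schanuel-blind)

Roy's Conjecture 2 [Roy2001] — equivalent to Schanuel's conjecture by Roy's Theorems 1 and 2 —
is stated for parameter quintuples in the *window*
`RoyAdmissible s₀ s₁ t₀ t₁ u : max{1,t₀,2t₁} < min{s₀,2s₁} ∧ max{s₀,s₁+t₁} < u < (1+t₀+t₁)/2`
(Roy 2001, condition (1); Waldschmidt 2022 survey, LNM 2313, Conjecture 8.1).
This file records the elementary consequences of the window that the quantitative wall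
statement (`run/shared/lean/ideation/Schanuel/solo-blind/paper/wall.md`, §3) relies on.
Everything is linear real arithmetic; the content is in *which* inequalities hold:

* `royAdmissible_ranges` : `1/2 < t₀ < 2`, `t₀ - 1 < t₁ < (1 + t₀)/3` (so `t₁ < 1`, `t₁ < t₀`),
  `1 < t₀ + t₁`, `1 < s₀`, `1/2 < s₁`, `1 < u < 2`.
* `royAdmissible_overdetermined` : `t₀ + t₁ < s₀ + s₁` — already for `l = 1` the number
  `≍ N^{s₀+l s₁}` of smallness conditions exceeds the number `≍ N^{t₀+t₁}` of coefficients of `P_N`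
  (the hypothesis is over-determined as a pointwise linear system; data nevertheless exist along
  genuine exponentials by one-variable interpolation, Roy 2001 Thm 3 / Roy 2002 Cor. 8.5 (i)).
* `royAdmissible_sub_tijdeman` : `u < t₀ + t₁` although `s₁ + t₁ < u` — the smallness exponent
  of Conjecture 2 lies strictly below `max{s₁+t₁, t₀+t₁} = t₀ + t₁`, the exponent beyond which
  *no* non-zero `P` with these degree bounds satisfies `|P(z,e^z)|_{N^{s₁}} ≤ exp(-N^u)`
  (Roy, *Interpolation formulas and auxiliary functions*, JNT 94 (2002), Cor. 8.5 (ii), p. 275,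
  from Tijdeman's zero estimate); the margin is `t₀ + t₁ - u > (t₀ + t₁ - 1)/2 > 0`.
* `royAdmissible_width` : `u < s₀ + 1/2 - max{1,t₀,2t₁}/4 ≤ s₀ + 1/4` — the window for `u` above
  the Liouville floor `max{s₀, s₁+t₁}` has width `< 1/4`, with supremum `1/4` approached only at
  `(t₀,t₁) → (1,1/2)`.
* `royAdmissible_height_surplus` : `s₀ + s₁ < 1 + t₀`.

[cite: Roy2001, condition (1) and Theorem 3; Roy 2002 JNT 94, Corollary 8.5; Waldschmidt 2022,
LNM 2313, Conjecture 8.1]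
-/

namespace Summit.Schanuel.Schanuel.Theorems

open Literature.NumberTheory.Transcendental

variable {s₀ s₁ t₀ t₁ u : ℝ}

/-- Unpacking of `RoyAdmissible` into the fourteen scalar inequalities it implies. -/
theorem royAdmissible_unpack (h : RoyAdmissible s₀ s₁ t₀ t₁ u) :
    0 < s₀ ∧ 0 < s₁ ∧ 0 < t₀ ∧ 0 < t₁ ∧ 0 < u ∧
    1 < s₀ ∧ t₀ < s₀ ∧ 2 * t₁ < s₀ ∧ 1 < 2 * s₁ ∧ t₀ < 2 * s₁ ∧ 2 * t₁ < 2 * s₁ ∧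
    s₀ < u ∧ s₁ + t₁ < u ∧ u < (1 + t₀ + t₁) / 2 := by
  obtain ⟨h0, h1, h2, h3, h4, h5, h6, h7⟩ := h
  have a1 : (1 : ℝ) ≤ max 1 (max t₀ (2 * t₁)) := le_max_left _ _
  have a2 : t₀ ≤ max 1 (max t₀ (2 * t₁)) := le_trans (le_max_left _ _) (le_max_right _ _)
  have a3 : 2 * t₁ ≤ max 1 (max t₀ (2 * t₁)) := le_trans (le_max_right _ _) (le_max_right _ _)
  have b1 : min s₀ (2 * s₁) ≤ s₀ := min_le_left _ _
  have b2 : min s₀ (2 * s₁) ≤ 2 * s₁ := min_le_right _ _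
  have c1 : s₀ ≤ max s₀ (s₁ + t₁) := le_max_left _ _
  have c2 : s₁ + t₁ ≤ max s₀ (s₁ + t₁) := le_max_right _ _
  refine ⟨h0, h1, h2, h3, h4, ?_, ?_, ?_, ?_, ?_, ?_, ?_, ?_, h7⟩ <;> linarith

/-- Ranges forced by Roy's window: `1/2 < t₀ < 2`, `t₀ - 1 < t₁ < (1+t₀)/3`, `t₁ < 1`, `t₁ < t₀`,
`1 < t₀ + t₁`, `1 < s₀`, `1/2 < s₁`, `1 < u < 2`. -/
theorem royAdmissible_ranges (h : RoyAdmissible s₀ s₁ t₀ t₁ u) :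
    1 / 2 < t₀ ∧ t₀ < 2 ∧ t₀ - 1 < t₁ ∧ t₁ < (1 + t₀) / 3 ∧ t₁ < 1 ∧ t₁ < t₀ ∧
    1 < t₀ + t₁ ∧ 1 < s₀ ∧ 1 / 2 < s₁ ∧ 1 < u ∧ u < 2 := by
  obtain ⟨h0, h1, h2, h3, h4, g1, g2, g3, g4, g5, g6, k1, k2, k3⟩ := royAdmissible_unpack h
  refine ⟨?_, ?_, ?_, ?_, ?_, ?_, ?_, ?_, ?_, ?_, ?_⟩ <;> nlinarith

/-- Over-determination: `t₀ + t₁ < s₀ + s₁` (more smallness conditions than coefficients, already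
for one point `y`). -/
theorem royAdmissible_overdetermined (h : RoyAdmissible s₀ s₁ t₀ t₁ u) :
    t₀ + t₁ < s₀ + s₁ := by
  obtain ⟨h0, h1, h2, h3, h4, g1, g2, g3, g4, g5, g6, k1, k2, k3⟩ := royAdmissible_unpack h
  linarith

/-- Sub-Tijdeman: the smallness exponent `u` of Conjecture 2 satisfies `s₁ + t₁ < u < t₀ + t₁`,
with margin `t₀ + t₁ - u > (t₀ + t₁ - 1)/2 > 0`; beyond `max{s₁+t₁, t₀+t₁}` no non-zero
polynomial is that small on `|z| ≤ N^{s₁}` (Roy 2002, Cor. 8.5 (ii)). -/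
theorem royAdmissible_sub_tijdeman (h : RoyAdmissible s₀ s₁ t₀ t₁ u) :
    s₁ + t₁ < u ∧ u < t₀ + t₁ ∧ (t₀ + t₁ - 1) / 2 < t₀ + t₁ - u ∧ 0 < (t₀ + t₁ - 1) / 2 := by
  obtain ⟨h0, h1, h2, h3, h4, g1, g2, g3, g4, g5, g6, k1, k2, k3⟩ := royAdmissible_unpack h
  refine ⟨k2, ?_, ?_, ?_⟩ <;> linarith

/-- Width of the window for `u`: `u < s₀ + 1/2 - max{1,t₀,2t₁}/4 ≤ s₀ + 1/4`; in particular
`u - max{s₀, s₁+t₁} < 1/4`. -/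
theorem royAdmissible_width (h : RoyAdmissible s₀ s₁ t₀ t₁ u) :
    u < s₀ + 1 / 2 - max 1 (max t₀ (2 * t₁)) / 4 ∧ u < s₀ + 1 / 4 ∧
    u < max s₀ (s₁ + t₁) + 1 / 4 := by
  have hw := h
  obtain ⟨-, -, -, -, -, h5, -, h7⟩ := h
  obtain ⟨h0, h1, h2, h3, h4, g1, g2, g3, g4, g5, g6, k1, k2, k3⟩ := royAdmissible_unpack hw
  have a1 : (1 : ℝ) ≤ max 1 (max t₀ (2 * t₁)) := le_max_left _ _
  have a2 : t₀ ≤ max 1 (max t₀ (2 * t₁)) := le_trans (le_max_left _ _) (le_max_right _ _)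
  have a3 : 2 * t₁ ≤ max 1 (max t₀ (2 * t₁)) := le_trans (le_max_right _ _) (le_max_right _ _)
  have b1 : min s₀ (2 * s₁) ≤ s₀ := min_le_left _ _
  have c1 : s₀ ≤ max s₀ (s₁ + t₁) := le_max_left _ _
  refine ⟨?_, ?_, ?_⟩ <;> linarith

/-- Height surplus bound: `s₀ + s₁ < 1 + t₀` (so `s₀ + s₁ - (t₀ + t₁) < 1 - t₁ < 1/2 + …`). -/
theorem royAdmissible_height_surplus (h : RoyAdmissible s₀ s₁ t₀ t₁ u) :
    s₀ + s₁ < 1 + t₀ ∧ s₀ + s₁ - (t₀ + t₁) < 1 - t₁ := by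
  obtain ⟨h0, h1, h2, h3, h4, g1, g2, g3, g4, g5, g6, k1, k2, k3⟩ := royAdmissible_unpack h
  constructor <;> linarith

/-- The corner `(s₀, s₁, t₀, t₁, u) = (1 + 3ε, 1/2 + 2ε, 1, 1/2, 1 + 4ε)` is admissible for every
`0 < ε < 1/40`: the window is non-empty near the point `(t₀, t₁) = (1, 1/2)` where its `u`-width
is maximal (cf. the in-tree example `royAdmissible_example : RoyAdmissible 1.3 0.7 1.2 0.5 1.32`). -/
theorem royAdmissible_corner {ε : ℝ} (hε : 0 < ε) (hε' : ε < 1 / 40) :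
    RoyAdmissible (1 + 3 * ε) (1 / 2 + 2 * ε) 1 (1 / 2) (1 + 4 * ε) := by
  refine ⟨by linarith, by linarith, by norm_num, by norm_num, by linarith, ?_, ?_, ?_⟩
  · rw [show max (1 : ℝ) (max 1 (2 * (1 / 2))) = 1 by norm_num]
    exact lt_min (by linarith) (by linarith)
  · exact max_lt (by linarith) (by linarith)
  · linarith

#harness_tags royAdmissible_sub_tijdeman

end Summit.Schanuel.Schanuel.Theorems
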